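import Mathlib
import Literature.AlgebraicGeometry.Resolution.QuadraticTransforms
import HarnessLib

/-!
# Route `RadicialJung`, crux `CleanModels` (stmt-15917), stub `stub_cleanLU3DefectArcInfinite`: «`Q`-CONSTANTS» — the
# algebraic substitute for Teichmüller coefficient fields along a discrete rank-one valuation

Line `Sketch` rev 20 of crux stmt-ResolutionOfSingularities-15917; lead `res-B-lead-1` g3.  OURS; nothing here proves resolution in
characteristic `p`.

Setting: `O` a valuation ring of the field `K` of characteristic `p`, `π ∈ O` an element whose value bounds every value `< 1`
(a value-generator of a discrete rank-one valuation), `Q = p^s`.  A `Q`-CONSTANT is a `Q`-th power `t^Q`, `t ∈ O` (or `t` in a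
local subring `R ⊆ O` dominated by `O`).  `Q`-constants are killed by every derivation, are closed under sums and products
(`(a + b)^Q = a^Q + b^Q`), and behave like Teichmüller digits to precision `Q`:

* `valuation_qconst_sub_qconst` («DIG») — two `Q`-constants either differ by a unit or agree to order `π^Q`:
  `v (t^Q - t'^Q) < 1 → v (t^Q - t'^Q) ≤ v π ^ Q`.
* `valuation_sum_eq_of_isolated` — a finite sum with one term of value `g` and all others of value `< g` has value `g`.
* `mem_pow_of_qconst_sum` («K1») — in a local subring `R ⊆ O` dominated by `O` containing `π`, a polynomial expression
  `Σ γ_a π^a` with `Q`-constant coefficients `γ_a = r_a^Q`, `r_a ∈ R`, of value `≤ v π ^ n` (`n ≤ Q`) lies in `𝔪_R ^ n`: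
  HIGH VALUE FORCES HIGH ORDER for constant-coefficient expressions (the coefficient of least index that is a unit carries the
  value).
* `exists_qconst_expansion` — if every residue of `O` is a `p`-th power (perfect residue field), every `b ∈ O` has, for every
  `B`, an expansion `b ≡ Σ_{r<B} e_r π^r (mod π^B)` with `Q`-constant digits `e_r`; `qconst_expansion_unique` («UNIQ») — two such
  expansions agreeing modulo `π^B`, `B ≤ Q`, have digits agreeing to order `π^Q`.
-/

noncomputable section

set_option linter.dupNamespace false -- mandated namespace of this single-conjunct summit

open IsLocalRing
open Literature.AlgebraicGeometry.Resolution

namespace Summit.ResolutionOfSingularities.ResolutionOfSingularities.Theorems.RadicialJung.CleanModels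

variable {K : Type} [Field K]

/-! ## Isolated terms -/

/-- A finite sum with one term of value `g ≠ 0` and all other terms of value `< g` has value `g`. [folklore] -/
theorem valuation_sum_eq_of_isolated (O : ValuationSubring K) {ι : Type*} [DecidableEq ι] (s : Finset ι) (f : ι → K)
    (i₀ : ι) (hi₀ : i₀ ∈ s) {g : O.ValueGroup} (hg : O.valuation (f i₀) = g) (hg0 : g ≠ 0)
    (hlt : ∀ i ∈ s, i ≠ i₀ → O.valuation (f i) < g) : O.valuation (∑ i ∈ s, f i) = g := by
  rw [← Finset.add_sum_erase s f hi₀]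
  have hrest : O.valuation (∑ i ∈ s.erase i₀, f i) < g :=
    Valuation.map_sum_lt _ hg0 fun i hi => hlt i (Finset.mem_of_mem_erase hi) (Finset.ne_of_mem_erase hi)
  rw [← hg] at hrest ⊢
  exact Valuation.map_add_eq_of_lt_left _ hrest

/-! ## `Q`-constants as digits -/

section Digits

variable (O : ValuationSubring K) (π : K) {p : ℕ} [hp : Fact p.Prime] [CharP K p]

/-- Powers of a value `0 < v π < 1` are strictly decreasing. [folklore] -/
theorem valuation_pow_lt_pow (hπ0 : π ≠ 0) (hvπ : O.valuation π < 1) {a b : ℕ} (hab : a < b) :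
    O.valuation π ^ b < O.valuation π ^ a := by
  have hpos : 0 < O.valuation π := zero_lt_iff.mpr ((Valuation.ne_zero_iff _).mpr hπ0)
  obtain ⟨c, rfl⟩ := Nat.exists_eq_add_of_lt hab
  rw [add_assoc, pow_add]
  have h1 : O.valuation π ^ (c + 1) < 1 := pow_lt_one₀ zero_le hvπ (by omega)
  calc O.valuation π ^ a * O.valuation π ^ (c + 1) < O.valuation π ^ a * 1 :=
        mul_lt_mul_of_pos_left h1 (pow_pos hpos a)
    _ = O.valuation π ^ a := mul_one _

/-- From `v π ^ b ≤ v π ^ a` (with `0 < v π < 1`) conclude `a ≤ b`. [folklore] -/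
theorem le_of_valuation_pow_le_pow (hπ0 : π ≠ 0) (hvπ : O.valuation π < 1) {a b : ℕ} (h : O.valuation π ^ b ≤ O.valuation π ^ a) :
    a ≤ b := by
  by_contra hlt
  exact absurd h (not_le.mpr (valuation_pow_lt_pow O π hπ0 hvπ (not_le.mp hlt)))

/-- **DIG.** Two `Q`-constants (`Q = p^s`) of `O` either differ by a unit or agree to order `π^Q`: if `v (t^Q - t'^Q) < 1` then
`v (t^Q - t'^Q) ≤ v π ^ Q`, because `t^Q - t'^Q = (t - t')^Q`. [folklore] -/
theorem valuation_qconst_sub_qconst (hπ : ∀ x : K, O.valuation x < 1 → O.valuation x ≤ O.valuation π) (s : ℕ)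
    (t t' : K) (hlt : O.valuation (t ^ p ^ s - t' ^ p ^ s) < 1) :
    O.valuation (t ^ p ^ s - t' ^ p ^ s) ≤ O.valuation π ^ p ^ s := by
  rw [← sub_pow_char_pow t t' s, map_pow] at hlt ⊢
  have h1 : O.valuation (t - t') < 1 := by
    by_contra hge
    push Not at hge
    exact absurd (one_le_pow₀ (M₀ := O.ValueGroup) hge) (not_le.mpr hlt)
  exact pow_le_pow_left' (hπ _ h1) _

/-- Iterating «every residue is a `p`-th power»: every residue is a `Q = p^s`-th power. [folklore] -/
theorem exists_sub_pow_pow_lt (hperf : ∀ b : K, b ∈ O → ∃ t : K, t ∈ O ∧ O.valuation (b - t ^ p) < 1) (s : ℕ) :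
    ∀ b : K, b ∈ O → ∃ t : K, t ∈ O ∧ O.valuation (b - t ^ p ^ s) < 1 := by
  induction s with
  | zero => intro b hb; exact ⟨b, hb, by simp⟩
  | succ s ih =>
    intro b hb
    obtain ⟨t, ht, hvt⟩ := ih b hb
    obtain ⟨t', ht', hvt'⟩ := hperf t ht
    refine ⟨t', ht', ?_⟩
    have e : b - t' ^ p ^ (s + 1) = (b - t ^ p ^ s) + (t - t' ^ p) ^ p ^ s := by
      rw [sub_pow_char_pow t (t' ^ p) s, pow_succ', pow_mul]; ring
    rw [e]
    refine lt_of_le_of_lt (Valuation.map_add _ _ _) (max_lt hvt ?_)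
    rw [map_pow]
    exact pow_lt_one₀ zero_le hvt' (pow_ne_zero _ hp.out.ne_zero)

/-- The same inside a subring `R ⊆ O` with lifts in `R`: if every element of `R` is a `p`-th power modulo the centre of `O`, it is a
`Q = p^s`-th power modulo the centre. [folklore] -/
theorem exists_sub_pow_pow_lt_subring (R : Subring K)
    (hperf : ∀ b : K, b ∈ R → ∃ t : K, t ∈ R ∧ O.valuation (b - t ^ p) < 1) (s : ℕ) :
    ∀ b : K, b ∈ R → ∃ t : K, t ∈ R ∧ O.valuation (b - t ^ p ^ s) < 1 := by
  induction s with
  | zero => intro b hb; exact ⟨b, hb, by simp⟩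
  | succ s ih =>
    intro b hb
    obtain ⟨t, ht, hvt⟩ := ih b hb
    obtain ⟨t', ht', hvt'⟩ := hperf t ht
    refine ⟨t', ht', ?_⟩
    have e : b - t' ^ p ^ (s + 1) = (b - t ^ p ^ s) + (t - t' ^ p) ^ p ^ s := by
      rw [sub_pow_char_pow t (t' ^ p) s, pow_succ', pow_mul]; ring
    rw [e]
    refine lt_of_le_of_lt (Valuation.map_add _ _ _) (max_lt hvt ?_)
    rw [map_pow]
    exact pow_lt_one₀ zero_le hvt' (pow_ne_zero _ hp.out.ne_zero)

/-- **`Q`-constant expansions exist** when every residue of `O` is a `p`-th power: every `b ∈ O` is, modulo `π^B`, a polynomial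
`Σ_{r<B} e_r π^r` in `π` with `Q`-constant digits `e_r = t_r^Q`, `t_r ∈ O`. [folklore] -/
theorem exists_qconst_expansion (hπ0 : π ≠ 0) (hπ : ∀ x : K, O.valuation x < 1 → O.valuation x ≤ O.valuation π)
    (hperf : ∀ b : K, b ∈ O → ∃ t : K, t ∈ O ∧ O.valuation (b - t ^ p) < 1) (s : ℕ) :
    ∀ (B : ℕ) (b : K), b ∈ O → ∃ e : ℕ → K, (∀ r, ∃ t : K, t ∈ O ∧ e r = t ^ p ^ s) ∧
      O.valuation (b - ∑ r ∈ Finset.range B, e r * π ^ r) ≤ O.valuation π ^ B := by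
  intro B
  induction B with
  | zero =>
    intro b hb
    refine ⟨fun _ => 0, fun _ => ⟨0, O.zero_mem, by rw [zero_pow (pow_ne_zero _ hp.out.ne_zero)]⟩, ?_⟩
    simp only [Finset.range_zero, Finset.sum_empty, sub_zero, pow_zero]
    exact (O.valuation_le_one_iff _).mpr hb
  | succ B ih =>
    intro b hb
    obtain ⟨e, he, hv⟩ := ih b hb
    have hpos : 0 < O.valuation π := zero_lt_iff.mpr ((Valuation.ne_zero_iff _).mpr hπ0)
    -- the next digit
    set b' : K := (b - ∑ r ∈ Finset.range B, e r * π ^ r) / π ^ B with hb'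
    have hb'O : b' ∈ O := by
      rw [← O.valuation_le_one_iff, hb', map_div₀, map_pow]
      exact div_le_one_of_le₀ hv zero_le
    obtain ⟨t, ht, hvt⟩ := exists_sub_pow_pow_lt O hperf s b' hb'O
    refine ⟨Function.update e B (t ^ p ^ s), fun r => ?_, ?_⟩
    · by_cases hr : r = B
      · subst hr; exact ⟨t, ht, by simp⟩
      · rw [Function.update_of_ne hr]; exact he r
    · rw [Finset.sum_range_succ, Function.update_self,
        Finset.sum_congr rfl fun r hr => by rw [Function.update_of_ne (Finset.mem_range.mp hr).ne]]
      have e1 : b - (∑ r ∈ Finset.range B, e r * π ^ r + t ^ p ^ s * π ^ B) = π ^ B * (b' - t ^ p ^ s) := by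
        rw [hb']; field_simp; ring
      rw [e1, map_mul, map_pow, pow_succ]
      exact mul_le_mul_right ((hπ _ hvt)) _

/-- **UNIQ.** Two `Q`-constant expansions agreeing modulo `π^B`, `B ≤ Q`, have digits agreeing to order `π^Q`. [folklore] -/
theorem qconst_expansion_unique (hπO : π ∈ O) (hπ0 : π ≠ 0) (hπ : ∀ x : K, O.valuation x < 1 → O.valuation x ≤ O.valuation π)
    (s B : ℕ) (hB : B ≤ p ^ s) (e e' : ℕ → K) (he : ∀ r, ∃ t : K, t ∈ O ∧ e r = t ^ p ^ s)
    (he' : ∀ r, ∃ t : K, t ∈ O ∧ e' r = t ^ p ^ s)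
    (h : O.valuation (∑ r ∈ Finset.range B, e r * π ^ r - ∑ r ∈ Finset.range B, e' r * π ^ r) ≤ O.valuation π ^ B) :
    ∀ r, r < B → O.valuation (e r - e' r) ≤ O.valuation π ^ p ^ s := by
  classical
  have hvπ1 : O.valuation π ≤ 1 := (O.valuation_le_one_iff _).mpr hπO
  have hpos : 0 < O.valuation π := zero_lt_iff.mpr ((Valuation.ne_zero_iff _).mpr hπ0)
  have hO : ∀ r, e r ∈ O ∧ e' r ∈ O := fun r => by
    obtain ⟨t, ht, ht'⟩ := he r; obtain ⟨u, hu, hu'⟩ := he' r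
    exact ⟨ht' ▸ O.pow_mem ht _, hu' ▸ O.pow_mem hu _⟩
  -- either all digits agree to order `Q`, or there is a least bad index
  by_contra hcon
  push Not at hcon
  obtain ⟨r₁, hr₁B, hr₁⟩ := hcon
  -- `v π < 1` (else `v π = 1` and every value `≤ 1` is fine)
  have hvπ : O.valuation π < 1 := by
    by_contra hge
    have h1 : O.valuation π = 1 := le_antisymm hvπ1 (not_lt.mp hge)
    apply (not_le.mpr hr₁)
    rw [h1, one_pow]
    exact (O.valuation_le_one_iff _).mpr (O.sub_mem (hO r₁).1 (hO r₁).2)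
  let P : ℕ → Prop := fun r => r < B ∧ ¬ O.valuation (e r - e' r) ≤ O.valuation π ^ p ^ s
  have hex : ∃ r, P r := ⟨r₁, hr₁B, not_le.mpr hr₁⟩
  let r₀ := Nat.find hex
  obtain ⟨hr₀B, hr₀⟩ : P r₀ := Nat.find_spec hex
  have hmin : ∀ r, r < r₀ → O.valuation (e r - e' r) ≤ O.valuation π ^ p ^ s := fun r hr => by
    have := Nat.find_min hex hr
    change ¬ (r < B ∧ _) at this
    push Not at this
    exact this (hr.trans hr₀B)
  -- the bad digit differs by a unit
  have hunit : O.valuation (e r₀ - e' r₀) = 1 := by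
    obtain ⟨t, ht, hte⟩ := he r₀; obtain ⟨u, hu, hue⟩ := he' r₀
    refine le_antisymm ((O.valuation_le_one_iff _).mpr (O.sub_mem (hO r₀).1 (hO r₀).2)) (not_lt.mp fun hlt => hr₀ ?_)
    rw [hte, hue] at hlt ⊢
    exact valuation_qconst_sub_qconst O π hπ s t u hlt
  -- hence the difference of the expansions has value `v π ^ r₀ > v π ^ B`
  have hval : O.valuation (∑ r ∈ Finset.range B, (e r - e' r) * π ^ r) = O.valuation π ^ r₀ := by
    refine valuation_sum_eq_of_isolated O (Finset.range B) (fun r => (e r - e' r) * π ^ r) r₀ (Finset.mem_range.mpr hr₀B)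
      (by rw [map_mul, map_pow, hunit, one_mul]) (pow_ne_zero _ hpos.ne') fun r hr hne => ?_
    rw [map_mul, map_pow]
    rcases lt_or_gt_of_ne hne with hlt | hgt
    · calc O.valuation (e r - e' r) * O.valuation π ^ r ≤ O.valuation π ^ p ^ s * O.valuation π ^ r :=
            mul_le_mul_left (hmin r hlt) _
        _ = O.valuation π ^ (p ^ s + r) := (pow_add _ _ _).symm
        _ < O.valuation π ^ r₀ := valuation_pow_lt_pow O π hπ0 hvπ (by omega)
    · calc O.valuation (e r - e' r) * O.valuation π ^ r ≤ 1 * O.valuation π ^ r :=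
            mul_le_mul_left ((O.valuation_le_one_iff _).mpr (O.sub_mem (hO r).1 (hO r).2)) _
        _ = O.valuation π ^ r := one_mul _
        _ < O.valuation π ^ r₀ := valuation_pow_lt_pow O π hπ0 hvπ hgt
  have hsum : ∑ r ∈ Finset.range B, e r * π ^ r - ∑ r ∈ Finset.range B, e' r * π ^ r =
      ∑ r ∈ Finset.range B, (e r - e' r) * π ^ r := by
    rw [← Finset.sum_sub_distrib]; exact Finset.sum_congr rfl fun r _ => by ring
  rw [hsum, hval] at h
  exact absurd (le_of_valuation_pow_le_pow O π hπ0 hvπ h) (not_le.mpr hr₀B)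

end Digits

/-! ## High value forces high order for `Q`-constant-coefficient polynomials -/

/-- **K1.** Let `R ⊆ O` be a local subring dominated by `O`, `π ∈ 𝔪_R` an element whose value bounds every value `< 1`, and
`C = Σ_{a ∈ ι} γ_a π^a` with `γ_a = r_a^Q` (`r_a ∈ R`, `Q = p^s`).  If `v C ≤ v π ^ n` with `n ≤ Q`, then `C ∈ 𝔪_R ^ n`.
(The least index whose coefficient is a unit carries the value of `C`; all other coefficients are in `𝔪^Q`.) [folklore] -/
theorem mem_pow_of_qconst_sum {O : ValuationSubring K} {p : ℕ} [Fact p.Prime] [CharP K p] {R : Subring K} [IsLocalRing R]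
    (hdom : SubringDominates R O.toSubring) (π : R) (hπ0 : (π : K) ≠ 0) (hvπ : O.valuation (π : K) < 1)
    (hπ : ∀ x : K, O.valuation x < 1 → O.valuation x ≤ O.valuation (π : K)) (s : ℕ) (ι : Finset ℕ) (γ : ℕ → R)
    (hγ : ∀ a ∈ ι, ∃ r : R, γ a = r ^ p ^ s) (n : ℕ) (hn : n ≤ p ^ s)
    (hv : O.valuation ((∑ a ∈ ι, γ a * π ^ a : R) : K) ≤ O.valuation (π : K) ^ n) :
    (∑ a ∈ ι, γ a * π ^ a) ∈ maximalIdeal R ^ n := by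
  classical
  have hRO : R ≤ O.toSubring := hdom.1
  have hmem : ∀ a : R, a ∈ maximalIdeal R ↔ O.valuation (a : K) < 1 := (subringDominates_valuationSubring_iff hRO).mp hdom
  have hle1 : ∀ a : R, O.valuation (a : K) ≤ 1 := fun a => (O.valuation_le_one_iff _).mpr (hRO a.2)
  have hunit1 : ∀ a : R, IsUnit a → O.valuation (a : K) = 1 := fun a ha =>
    le_antisymm (hle1 a) (not_lt.mp fun hlt => (mem_maximalIdeal _ |>.mp ((hmem a).mpr hlt)) ha)
  have hpos : 0 < O.valuation (π : K) := zero_lt_iff.mpr ((Valuation.ne_zero_iff _).mpr hπ0)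
  have hπm : π ∈ maximalIdeal R := (hmem π).mpr hvπ
  -- a non-unit `Q`-constant lies in `𝔪^Q`
  have hnu : ∀ a ∈ ι, ¬ IsUnit (γ a) → γ a ∈ maximalIdeal R ^ p ^ s := by
    intro a ha hna
    obtain ⟨r, hr⟩ := hγ a ha
    have hrm : r ∈ maximalIdeal R := by
      refine (mem_maximalIdeal _).mpr (mem_nonunits_iff.mpr fun hru => hna ?_)
      rw [hr]; exact hru.pow _
    rw [hr]; exact Ideal.pow_mem_pow hrm _
  -- the unit coefficients of index `< n`
  let U : Finset ℕ := ι.filter fun a => a < n ∧ IsUnit (γ a)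
  by_cases hU : U = ∅
  · -- every term lies in `𝔪^n`
    refine Ideal.sum_mem _ fun a ha => ?_
    by_cases han : a < n
    · have hna : ¬ IsUnit (γ a) := fun hu => by
        have : a ∈ U := Finset.mem_filter.mpr ⟨ha, han, hu⟩
        rw [hU] at this; exact absurd this (Finset.notMem_empty a)
      exact Ideal.mul_mem_right _ _ (Ideal.pow_le_pow_right hn (hnu a ha hna))
    · exact Ideal.mul_mem_left _ _ (Ideal.pow_le_pow_right (not_lt.mp han) (Ideal.pow_mem_pow hπm _))
  · -- the least unit index `a₀ < n` carries the value: contradiction with `hv`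
    exfalso
    obtain ⟨a₀, ha₀U, hmin⟩ := Finset.exists_min_image U id (Finset.nonempty_iff_ne_empty.mpr hU)
    obtain ⟨ha₀ι, ha₀n, ha₀u⟩ := Finset.mem_filter.mp ha₀U
    have hval : O.valuation ((∑ a ∈ ι, γ a * π ^ a : R) : K) = O.valuation (π : K) ^ a₀ := by
      rw [AddSubmonoidClass.coe_finsetSum]
      simp only [Subring.coe_mul, Subring.coe_pow]
      refine valuation_sum_eq_of_isolated O ι (fun a => (γ a : K) * (π : K) ^ a) a₀ ha₀ι
        (by rw [map_mul, map_pow, hunit1 _ ha₀u, one_mul]) (pow_ne_zero _ hpos.ne') fun a ha hne => ?_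
      rw [map_mul, map_pow]
      by_cases hau : a < n ∧ IsUnit (γ a)
      · -- another unit index: larger than `a₀`
        have haU : a ∈ U := Finset.mem_filter.mpr ⟨ha, hau⟩
        have hgt : a₀ < a := lt_of_le_of_ne (hmin a haU) (Ne.symm hne)
        rw [hunit1 _ hau.2, one_mul]
        exact valuation_pow_lt_pow O (π : K) hπ0 hvπ hgt
      · by_cases han : a < n
        · -- non-unit coefficient of small index: value `≤ v π ^ (Q + a) < v π ^ a₀`
          have hna : ¬ IsUnit (γ a) := fun hu => hau ⟨han, hu⟩
          obtain ⟨r, hr⟩ := hγ a ha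
          have hrm : O.valuation (r : K) < 1 := by
            refine (hmem r).mp ((mem_maximalIdeal _).mpr (mem_nonunits_iff.mpr fun hru => hna ?_))
            rw [hr]; exact hru.pow _
          have hγv : O.valuation (γ a : K) ≤ O.valuation (π : K) ^ p ^ s := by
            rw [hr, Subring.coe_pow, map_pow]; exact pow_le_pow_left' (hπ _ hrm) _
          calc O.valuation (γ a : K) * O.valuation (π : K) ^ a ≤ O.valuation (π : K) ^ p ^ s * O.valuation (π : K) ^ a :=
                mul_le_mul_left hγv _
            _ = O.valuation (π : K) ^ (p ^ s + a) := (pow_add _ _ _).symm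
            _ < O.valuation (π : K) ^ a₀ := valuation_pow_lt_pow O (π : K) hπ0 hvπ (by omega)
        · -- large index
          calc O.valuation (γ a : K) * O.valuation (π : K) ^ a ≤ 1 * O.valuation (π : K) ^ a := mul_le_mul_left (hle1 _) _
            _ = O.valuation (π : K) ^ a := one_mul _
            _ < O.valuation (π : K) ^ a₀ := valuation_pow_lt_pow O (π : K) hπ0 hvπ (by omega)
    rw [hval] at hv
    exact absurd (le_of_valuation_pow_le_pow O (π : K) hπ0 hvπ hv) (not_le.mpr ha₀n)

end Summit.ResolutionOfSingularities.ResolutionOfSingularities.Theorems.RadicialJung.CleanModels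

end
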